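import Literature.NumberTheory.PAdicHodge.AinfWeierstrassHodgeTateCoordinate
import HarnessLib

/-!
# `gr¹B_dR⁺ ≅ ℂ_F(1)`: the Galois rule of the coordinate `θ(x/ξ_dR)` and of the Hodge–Tate coordinate of `Ŵ`

Topic `Literature/NumberTheory/PAdicHodge`; sequel of `AinfWeierstrassHodgeTateCoordinate`. `Γ_F` preserves
`Fil¹ = (ξ_dR)` (tree `galBdRPlus_mem_span`), so `σ(ξ_dR) = ξ_dR · v_σ`; the 1-cocycle `c(σ) := θ(v_σ) ∈ ℂ_F` (with values
in `𝒪_{ℂ_F}^×`; it is the Tate twist: `gr¹B_dR⁺ ≅ ℂ_F(1)`) governs the Galois behaviour of the coordinate: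

* `BdRPlusTop.xiCocycle hθ σ = θ(σ(ξ_dR)/ξ_dR)`; **`grCoord_gal`: `θ(σx/ξ_dR) = c(σ) · σ(θ(x/ξ_dR))`**;
* **`AinfTop.htCoord_galSeq`: `htCoord(σ t) = c(σ) · σ(htCoord t)`** for Tate-module points of `Ŵ(𝒪_{ℂ_F})`.

With `htCoord_addSeq` (additivity) this says: `t ↦ htCoord t` is a `Γ_F`-equivariant homomorphism `T_pŴ(𝒪_{ℂ_F}) → ℂ_F(1)`
(Tate's Hodge–Tate map; Tate 1967 §4, Fontaine 1982 §5). Definitions (reviewed): `xiCocycle`. No named facts, no `sorry`.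

## References
* J.-M. Fontaine, *Le corps des périodes p-adiques*, Astérisque 223 (1994), Exp. II §1.5.2–1.5.5. [FontaineAsterisque223III]
* J. T. Tate, *p-divisible groups* (Driebergen 1966), Springer 1967, §4. [Tate1967]
-/

noncomputable section

open Ideal Field WittVector MvPowerSeries

namespace Literature.NumberTheory.PAdicHodge

open Literature.NumberTheory.GaloisRepresentations
open Literature.NumberTheory.GaloisRepresentations.IsNonarchimedeanLocalField
open Literature.NumberTheory.GaloisRepresentations.LubinTate

variable {F : Type} [Field F] [ValuativeRel F] [TopologicalSpace F] [IsNonarchimedeanLocalField F] [CharZero F]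
  {p : ℕ} [Fact p.Prime] [Fact (¬ IsUnit (p : integerC F))]
  [IsAdicComplete (Ideal.span {(p : integerC F)}) (integerC F)]

namespace BdRPlusTop

/-- `σ(ξ_dR)` is a multiple of `ξ_dR`. [cite: FontaineAsterisque223III, Exp. II §1.5.2] -/
theorem exists_gal_xi_eq_mul (σ : absoluteGaloisGroup F) : ∃ v : BdRPlusTop F p, gal F p σ (of F p xiBdR) = of F p xiBdR * v := by
  have h : gal F p σ (of F p xiBdR) ∈ (WithIdeal.i : Ideal (BdRPlusTop F p)) :=
    ideal_map_gal_le σ (Ideal.mem_map_of_mem _ (by rw [ideal_eq]; exact Ideal.mem_span_singleton_self _))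
  rw [ideal_eq] at h
  obtain ⟨v, hv⟩ := Ideal.mem_span_singleton'.1 h
  exact ⟨v, by rw [← hv, mul_comm]⟩

/-- **The cocycle `c(σ) = θ(σ(ξ_dR)/ξ_dR) ∈ ℂ_F`** (the Tate twist of `gr¹B_dR⁺`). [cite: FontaineAsterisque223III, Exp. II §1.5.5] -/
def xiCocycle (σ : absoluteGaloisGroup F) : CompletedAlgClosure F :=
  thetaBdR ((of F p).symm (Classical.choose (exists_gal_xi_eq_mul (F := F) (p := p) σ)))

/-- `σ(ξ_dR) = ξ_dR · v_σ` for the chosen `v_σ`. [cite: FontaineAsterisque223III, Exp. II §1.5.2] -/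
theorem gal_xi_eq_mul_choose (σ : absoluteGaloisGroup F) :
    gal F p σ (of F p xiBdR) = of F p xiBdR * Classical.choose (exists_gal_xi_eq_mul (F := F) (p := p) σ) :=
  Classical.choose_spec (exists_gal_xi_eq_mul (F := F) (p := p) σ)

/-- **Galois rule of the coordinate: `θ(σx/ξ_dR) = c(σ) · σ(θ(x/ξ_dR))`** for `x ∈ Fil¹`.
[cite: FontaineAsterisque223III, Exp. II §1.5.5] -/
theorem grCoord_gal (hθ : Function.Surjective (fontaineTheta (integerC F) p)) (σ : absoluteGaloisGroup F)
    (x : (filOne F p).toIdeal) :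
    grCoord ⟨gal F p σ x, gal_mem_filOne σ x.2⟩ = xiCocycle (p := p) σ * σ • grCoord x := by
  set y := Classical.choose (exists_eq_xi_mul x) with hy
  set v := Classical.choose (exists_gal_xi_eq_mul (F := F) (p := p) σ) with hv
  have hx : (x : BdRPlusTop F p) = of F p xiBdR * y := eq_xi_mul_choose x
  have hσx : gal F p σ (x : BdRPlusTop F p) = of F p xiBdR * (v * gal F p σ y) := by
    rw [hx, map_mul, gal_xi_eq_mul_choose, mul_assoc]
  rw [grCoord_spec hθ ⟨gal F p σ x, gal_mem_filOne σ x.2⟩ hσx, map_mul, map_mul, grCoord_spec hθ x hx, xiCocycle]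
  congr 1
  exact thetaBdR_galBdRPlus σ ((of F p).symm y)

end BdRPlusTop

namespace AinfTop

variable {hθ : Function.Surjective (fontaineTheta (integerC F) p)} (W : WeierstrassCurve ℤ)

/-- **Galois rule of the Hodge–Tate coordinate: `htCoord(σ t) = c(σ) · σ(htCoord t)`** — `t ↦ htCoord t` is a
`Γ_F`-equivariant homomorphism `T_pŴ(𝒪_{ℂ_F}) → ℂ_F(1)` (with `htCoord_addSeq`). [cite: Tate1967, §4] [cite: FontaineAsterisque223III, Exp. II §1.5.5] -/
theorem htCoord_galSeq (σ : absoluteGaloisGroup F) {t : ℕ → (maxNilIdealC F).toIdeal} (ht0 : (t 0 : CBall F) = 0)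
    (htp : ∀ n, mulPC F p W (t (n + 1)) = t n) :
    htCoord W hθ (galSeq F σ t) (coe_galSeq_zero σ ht0) (mulPC_galSeq W hθ σ htp) =
      BdRPlusTop.xiCocycle (p := p) σ * σ • htCoord W hθ t ht0 htp := by
  rw [htCoord, htCoord, ← BdRPlusTop.grCoord_gal hθ σ]
  congr 1
  exact Subtype.ext (gal_torsionLiftFil W σ ht0 htp).symm

end AinfTop

end Literature.NumberTheory.PAdicHodge

end
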